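import Summits.PneNP.PneNP.Theorems.KarlinRubinMonotoneBlindSwitchCodes

/-!
# Route KarlinRubin, crux `MonotoneBlind` (stmt-PneNP-18027): clique-restriction switching — the count

Fourth file of the clique-restriction switching lemma (seat write-up `MonotoneBlind_AC0_announce.md`): the
Razborov–Beame count with VERTEX accounting, assembled from completeness (`exists_code_of_swRun`), resampling
(`switch_resample_le`), simulation (`swDec_eq_of_swFwd`) and the decoder's code count (`switch_card_codes_dec_le`).
For a sub-universe `V₁` drawn uniformly among the `n₁`-subsets of `V`:

* `switch_card_supersets_le` — the `n₁`-subsets of `V` containing a set of `≥ v₀` vertices number `≤ C(#V-v₀, n₁-v₀)`;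
* `switch_count` — **the count**: summed over `V₁`, the inputs whose canonical run (for some inside assignment) queries
  slots meeting `≥ v₀` vertices while every pending clause is small number at most
  `2^{C(v₀-1,2)+r} · (2(P+1)^{2r})^{C(v₀-1,2)+1} · 2^{#slots} · C(#V - v₀, n₁ - v₀)`.

All `--supports stmt-PneNP-18027`; no definitions.
-/

set_option linter.dupNamespace false -- `Summit.PneNP.PneNP.…`: summit = sub-problem (D-0017)

namespace Summit.PneNP.PneNP.Theorems

open Finset
open Literature.Computability.Complexity
open Literature.Probability.RandomGraphs.PlantedClique

variable {n : ℕ}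

/-! ### Sub-universes containing the revealed vertices -/

/-- **Supersets count.** The `n₁`-subsets of `V` containing a set `Zf` with `v₀ ≤ #Zf` number at most
`C(#V - v₀, n₁ - v₀)`. [folklore] -/
theorem switch_card_supersets_le (V : Finset (Fin n)) (n₁ v₀ : ℕ) (Zf : Finset (Fin n)) (hZ : v₀ ≤ #Zf) :
    #((powersetCard n₁ V).filter fun V₁ => Zf ⊆ V₁) ≤ (#V - v₀).choose (n₁ - v₀) := by
  classical
  -- shrink to a `v₀`-subset `Z₀ ⊆ Zf`
  obtain ⟨Z₀, hZ₀Z, hZ₀card⟩ := exists_subset_card_eq hZ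
  by_cases hZ₀V : Z₀ ⊆ V
  swap
  · rw [Finset.card_eq_zero.2]
    · exact Nat.zero_le _
    rw [filter_eq_empty_iff]
    intro V₁ hV₁ hZV₁
    rw [mem_powersetCard] at hV₁
    exact hZ₀V (hZ₀Z.trans (hZV₁.trans hV₁.1))
  calc #((powersetCard n₁ V).filter fun V₁ => Zf ⊆ V₁)
      ≤ #(powersetCard (n₁ - v₀) (V \ Z₀)) := by
        refine card_le_card_of_injOn (fun V₁ => V₁ \ Z₀) (fun V₁ hV₁ => ?_) ?_
        · rw [mem_coe, mem_filter, mem_powersetCard] at hV₁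
          obtain ⟨⟨hV₁V, hV₁card⟩, hZV₁⟩ := hV₁
          rw [mem_coe, mem_powersetCard]
          refine ⟨sdiff_subset_sdiff hV₁V subset_rfl, ?_⟩
          rw [card_sdiff_of_subset (hZ₀Z.trans hZV₁), hV₁card, hZ₀card]
        · intro V₁ hV₁ V₂ hV₂ h
          rw [mem_coe, mem_filter] at hV₁ hV₂
          have h1 : Z₀ ⊆ V₁ := hZ₀Z.trans hV₁.2
          have h2 : Z₀ ⊆ V₂ := hZ₀Z.trans hV₂.2
          rw [← sdiff_union_of_subset h1, ← sdiff_union_of_subset h2]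
          simp only at h
          rw [h]
    _ = (#V - v₀).choose (n₁ - v₀) := by
        rw [card_powersetCard, card_sdiff_of_subset hZ₀V, hZ₀card]

/-! ### The count -/

open Classical in
/-- **The Razborov–Beame count with vertex accounting.** Summed over the `n₁`-subsets `V₁` of `V`, the inputs `x` for
which some inside assignment has a canonical run (clause list `l`, restriction `(V₁, x)`) querying slots that meet
`≥ v₀` vertices, while every pending clause has `≤ P` slots of which `≤ r` inside `V₁`, number at most
`2^{C(v₀-1,2)+r} · (2(P+1)^{2r})^{C(v₀-1,2)+1} · 2^{#slots} · C(#V - v₀, n₁ - v₀)`. [cite: Beame1994, §3] -/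
theorem switch_count (V : Finset (Fin n)) (n₁ : ℕ) (l : List (Finset (⊤ : SimpleGraph (Fin n)).edgeSet))
    (P r v₀ : ℕ) (hv₀ : 0 < v₀) :
    ∑ V₁ ∈ powersetCard n₁ V, #(univ.filter fun x : EdgeVec n =>
        (∃ z : EdgeVec n, v₀ ≤ #(univ.filter fun v : Fin n =>
          ∃ e ∈ (swRun V₁ x z l ∅).2, v ∈ (e : Sym2 (Fin n)))) ∧
        ∀ S ∈ l, (∀ e ∈ S, (¬ ∀ v ∈ (e : Sym2 (Fin n)), v ∈ V₁) → x e = false) →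
          #S ≤ P ∧ #(S.filter fun e : (⊤ : SimpleGraph (Fin n)).edgeSet => ∀ v ∈ (e : Sym2 (Fin n)), v ∈ V₁) ≤ r) ≤
      2 ^ ((v₀ - 1).choose 2 + r) * (2 * (P + 1) ^ (2 * r)) ^ ((v₀ - 1).choose 2 + 1) *
        2 ^ Fintype.card (⊤ : SimpleGraph (Fin n)).edgeSet * (#V - v₀).choose (n₁ - v₀) := by
  set M := (v₀ - 1).choose 2 + 1 with hM
  set codes := (range (M + 1)).biUnion fun m => (univ : Finset (Fin m →
      Finset (⊤ : SimpleGraph (Fin n)).edgeSet × Finset (⊤ : SimpleGraph (Fin n)).edgeSet)).image List.ofFn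
    with hcodes
  have hmem : ∀ c, c ∈ codes ↔ c.length ≤ M := fun c => mem_codes_iff M c
  -- shorthands for the five events
  set bad : Finset (Fin n) → Finset (EdgeVec n) := fun V₁ => univ.filter fun x : EdgeVec n =>
      (∃ z : EdgeVec n, v₀ ≤ #(univ.filter fun v : Fin n =>
        ∃ e ∈ (swRun V₁ x z l ∅).2, v ∈ (e : Sym2 (Fin n)))) ∧
      ∀ S ∈ l, (∀ e ∈ S, (¬ ∀ v ∈ (e : Sym2 (Fin n)), v ∈ V₁) → x e = false) →
        #S ≤ P ∧ #(S.filter fun e : (⊤ : SimpleGraph (Fin n)).edgeSet => ∀ v ∈ (e : Sym2 (Fin n)), v ∈ V₁) ≤ r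
    with hbad
  set fwdSome : Finset (Fin n) → List (Finset (⊤ : SimpleGraph (Fin n)).edgeSet ×
      Finset (⊤ : SimpleGraph (Fin n)).edgeSet) → Finset (EdgeVec n) := fun V₁ c =>
    univ.filter fun x : EdgeVec n => (swFwd V₁ x P r v₀ c l ∅ ∅ ∅).isSome = true with hfwdSome
  set fwdWhite : Finset (Fin n) → List (Finset (⊤ : SimpleGraph (Fin n)).edgeSet ×
      Finset (⊤ : SimpleGraph (Fin n)).edgeSet) → Finset (EdgeVec n) := fun V₁ c =>
    univ.filter fun x : EdgeVec n => ∃ Zf : Finset (Fin n), ∃ F : Finset (⊤ : SimpleGraph (Fin n)).edgeSet,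
      swFwd V₁ x P r v₀ c l ∅ ∅ ∅ = some (Zf, F) ∧ ∀ e ∈ F, x e = false with hfwdWhite
  set decGood : Finset (Fin n) → List (Finset (⊤ : SimpleGraph (Fin n)).edgeSet ×
      Finset (⊤ : SimpleGraph (Fin n)).edgeSet) → Finset (EdgeVec n) := fun V₁ c =>
    univ.filter fun x : EdgeVec n => ∃ Zf : Finset (Fin n),
      swDec x P r v₀ c l ∅ ∅ ∅ = some Zf ∧ Zf ⊆ V₁ ∧ v₀ ≤ #Zf with hdecGood
  set decSome : List (Finset (⊤ : SimpleGraph (Fin n)).edgeSet ×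
      Finset (⊤ : SimpleGraph (Fin n)).edgeSet) → Finset (EdgeVec n) := fun c =>
    univ.filter fun x : EdgeVec n => (swDec x P r v₀ c l ∅ ∅ ∅).isSome = true with hdecSome
  -- (a) completeness: a bad input has a successful code of length `≤ M`
  have ha : ∀ V₁ : Finset (Fin n), #(bad V₁) ≤ ∑ c ∈ codes, #(fwdSome V₁ c) := by
    intro V₁
    calc #(bad V₁) ≤ #(codes.biUnion fun c => fwdSome V₁ c) := by
          refine card_le_card fun x hx => ?_
          rw [hbad, mem_filter] at hx
          obtain ⟨-, ⟨z, hz⟩, hstr⟩ := hx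
          obtain ⟨c, hlen, hsome⟩ := exists_code_of_swRun V₁ x P r v₀ z l ∅ ∅ hstr (by simp) (by simp)
            (by simpa using hv₀) hz
          rw [mem_biUnion]
          refine ⟨c, (hmem c).2 (by simpa using hlen), ?_⟩
          rw [hfwdSome, mem_filter]
          refine ⟨mem_univ _, ?_⟩
          simpa using hsome
      _ ≤ ∑ c ∈ codes, #(fwdSome V₁ c) := card_biUnion_le
  -- (b) resampling
  have hb : ∀ V₁ c, #(fwdSome V₁ c) ≤ 2 ^ ((v₀ - 1).choose 2 + r) * #(fwdWhite V₁ c) :=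
    fun V₁ c => switch_resample_le V₁ P r v₀ hv₀ c l
  -- (c) simulation + soundness
  have hc : ∀ V₁ c, fwdWhite V₁ c ⊆ decGood V₁ c := by
    intro V₁ c x hx
    rw [hfwdWhite, mem_filter] at hx
    obtain ⟨-, Zf, F, hrun, hF⟩ := hx
    have hs := swFwd_sound V₁ x P r v₀ c l ∅ ∅ ∅ Zf F (by simp) (empty_subset _) (by simpa using hv₀) hrun
    have hd := swDec_eq_of_swFwd V₁ x P r v₀ (x' := x) (fun _ _ => rfl) c l ∅ ∅ ∅ Zf F (empty_subset _)
      (by simp) hF hrun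
    rw [hdecGood, mem_filter]
    exact ⟨mem_univ _, Zf, hd, hs.1, hs.2.1⟩
  -- (d) vertex containment: sum over `V₁` first
  have hd : ∀ c, ∑ V₁ ∈ powersetCard n₁ V, #(decGood V₁ c) ≤ #(decSome c) * (#V - v₀).choose (n₁ - v₀) := by
    intro c
    have hswap : ∑ V₁ ∈ powersetCard n₁ V, #(decGood V₁ c) =
        ∑ x : EdgeVec n, #((powersetCard n₁ V).filter fun V₁ => ∃ Zf : Finset (Fin n),
          swDec x P r v₀ c l ∅ ∅ ∅ = some Zf ∧ Zf ⊆ V₁ ∧ v₀ ≤ #Zf) :=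
      sum_card_bipartiteAbove_eq_sum_card_bipartiteBelow
        (r := fun V₁ (x : EdgeVec n) => ∃ Zf : Finset (Fin n), swDec x P r v₀ c l ∅ ∅ ∅ = some Zf ∧ Zf ⊆ V₁ ∧ v₀ ≤ #Zf)
    rw [hswap]
    have hpt : ∀ x : EdgeVec n, #((powersetCard n₁ V).filter fun V₁ => ∃ Zf : Finset (Fin n),
          swDec x P r v₀ c l ∅ ∅ ∅ = some Zf ∧ Zf ⊆ V₁ ∧ v₀ ≤ #Zf) ≤
        (if (swDec x P r v₀ c l ∅ ∅ ∅).isSome = true then 1 else 0) * (#V - v₀).choose (n₁ - v₀) := by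
      intro x
      cases hrun : swDec x P r v₀ c l ∅ ∅ ∅ with
      | none =>
        rw [Finset.card_eq_zero.2]
        · exact Nat.zero_le _
        rw [filter_eq_empty_iff]
        rintro V₁ - ⟨Zf, h, -⟩
        exact absurd h (by simp)
      | some Zf =>
        simp only [Option.isSome_some, if_true, one_mul]
        by_cases hZf : v₀ ≤ #Zf
        · refine le_trans (card_le_card fun V₁ hV₁ => ?_) (switch_card_supersets_le V n₁ v₀ Zf hZf)
          rw [mem_filter] at hV₁ ⊢
          obtain ⟨hV₁, Zf', h, hsub, -⟩ := hV₁
          rw [Option.some.injEq] at h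
          exact ⟨hV₁, h ▸ hsub⟩
        · rw [Finset.card_eq_zero.2]
          · exact Nat.zero_le _
          rw [filter_eq_empty_iff]
          rintro V₁ - ⟨Zf', h, -, hcard⟩
          rw [Option.some.injEq] at h
          exact hZf (h ▸ hcard)
    calc ∑ x : EdgeVec n, #((powersetCard n₁ V).filter fun V₁ => ∃ Zf : Finset (Fin n),
          swDec x P r v₀ c l ∅ ∅ ∅ = some Zf ∧ Zf ⊆ V₁ ∧ v₀ ≤ #Zf)
        ≤ ∑ x : EdgeVec n, (if (swDec x P r v₀ c l ∅ ∅ ∅).isSome = true then 1 else 0) *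
            (#V - v₀).choose (n₁ - v₀) := sum_le_sum fun x _ => hpt x
      _ = #(decSome c) * (#V - v₀).choose (n₁ - v₀) := by
          rw [← sum_mul, hdecSome, card_filter]
  -- (e) codes accepted by the decoder, summed over inputs
  have he : ∑ c ∈ codes, #(decSome c) ≤
      2 ^ Fintype.card (⊤ : SimpleGraph (Fin n)).edgeSet * (2 * (P + 1) ^ (2 * r)) ^ M := by
    have hswap : ∑ c ∈ codes, #(decSome c) =
        ∑ x : EdgeVec n, #(codes.filter fun c => (swDec x P r v₀ c l ∅ ∅ ∅).isSome = true) :=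
      sum_card_bipartiteAbove_eq_sum_card_bipartiteBelow
        (r := fun c (x : EdgeVec n) => (swDec x P r v₀ c l ∅ ∅ ∅).isSome = true)
    rw [hswap]
    calc ∑ x : EdgeVec n, #(codes.filter fun c => (swDec x P r v₀ c l ∅ ∅ ∅).isSome = true)
        ≤ ∑ _x : EdgeVec n, (2 * (P + 1) ^ (2 * r)) ^ M :=
          sum_le_sum fun x _ => switch_card_codes_dec_le x P r v₀ l M ∅ ∅ ∅
      _ = 2 ^ Fintype.card (⊤ : SimpleGraph (Fin n)).edgeSet * (2 * (P + 1) ^ (2 * r)) ^ M := by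
          rw [sum_const, smul_eq_mul, card_univ]
          congr 1
          simp only [EdgeVec, Fintype.card_fun, Fintype.card_bool]
  -- assembly
  calc ∑ V₁ ∈ powersetCard n₁ V, #(bad V₁)
      ≤ ∑ V₁ ∈ powersetCard n₁ V, ∑ c ∈ codes, 2 ^ ((v₀ - 1).choose 2 + r) * #(decGood V₁ c) := by
        refine sum_le_sum fun V₁ _ => (ha V₁).trans (sum_le_sum fun c _ => (hb V₁ c).trans ?_)
        exact Nat.mul_le_mul_left _ (card_le_card (hc V₁ c))
    _ = 2 ^ ((v₀ - 1).choose 2 + r) * ∑ c ∈ codes, ∑ V₁ ∈ powersetCard n₁ V, #(decGood V₁ c) := by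
        rw [sum_comm, mul_sum]
        refine sum_congr rfl fun c _ => ?_
        rw [mul_sum]
    _ ≤ 2 ^ ((v₀ - 1).choose 2 + r) * ∑ c ∈ codes, #(decSome c) * (#V - v₀).choose (n₁ - v₀) :=
        Nat.mul_le_mul_left _ (sum_le_sum fun c _ => hd c)
    _ = 2 ^ ((v₀ - 1).choose 2 + r) * ((∑ c ∈ codes, #(decSome c)) * (#V - v₀).choose (n₁ - v₀)) := by
        rw [sum_mul]
    _ ≤ 2 ^ ((v₀ - 1).choose 2 + r) * ((2 ^ Fintype.card (⊤ : SimpleGraph (Fin n)).edgeSet *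
          (2 * (P + 1) ^ (2 * r)) ^ M) * (#V - v₀).choose (n₁ - v₀)) :=
        Nat.mul_le_mul_left _ (Nat.mul_le_mul_right _ he)
    _ = _ := by rw [hM]; ring

/-- Registered stub `stub_switchMain` of the clique-restriction switching line (the supersets count behind the
vertex accounting). [folklore] -/
theorem stub_switchMain :
    ∀ (n n₁ v₀ : ℕ) (V Zf : Finset (Fin n)), v₀ ≤ Zf.card →
      ((Finset.powersetCard n₁ V).filter fun V₁ => Zf ⊆ V₁).card ≤ (V.card - v₀).choose (n₁ - v₀) :=
  fun _ n₁ v₀ V Zf h => switch_card_supersets_le V n₁ v₀ Zf h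

end Summit.PneNP.PneNP.Theorems
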